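import Summits.ValiantsHypothesis.ValiantsHypothesis.Theses.NewtonUnitEquations
import Literature.Computability.AlgebraicComplexity.NewtonPolygonTauTransfer

set_option linter.dupNamespace false

/-!
# Disproof work file for crux `TwoProducts` (stmt-ValiantsHypothesis-5906) — findings

Crux (`Summit.ValiantsHypothesis.ValiantsHypothesis.Theses.NewtonUnitEquations.TwoProducts`, shared with route
NewtonFrames): `∃ a b, ∀ m t (f g : Fin m → ℂ[X,Y])` `t`-sparse, `#vert Newt(∏ f − ∏ g) ≤ 2^(a·m)·(t+2)^b`.

STATUS (cdisprove seat, end of cycle 1, v3): **no kill**; line `corner-log-linearization` picked, its 7 stubs survive (§3 Targets).  A refutation needs a family with `≥ t^{c·m}` hull vertices with BOTH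
`m` and `t` unbounded (`t` fixed ⇒ `|supp| ≤ 2t^m ≤ 2^{am}`; `m` fixed ⇒ `≤ 2t^m ≤ (t+2)^b`); it would refute KPTT's
Conjecture 1 at `k = 2` and answer KPTT §5 (both printed-open).  What this file certifies / records:

* §1 LOAD-BEARING HYPOTHESES: each sparsity hypothesis is needed (`twoProducts_false_without_sparsityF/G`), and the
  bound cannot be made independent of `t` (`not_twoProductsBoundFreeOfT`); witnesses are the KPTT parabola polynomial
  `KPTT.kpttPoly n` (`2^n` vertices, tree theorem `KPTT.newtonVertexCount_kpttPoly`).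
* §2 the bound cannot be made independent of `m` either (`not_twoProductsBoundFreeOfM`): the product of the `n`
  binomials `1 + X·Y^j` (`j < n`) has the `n+1` parabola points `(k, k(k-1)/2)` among its hull vertices
  (`le_vert_qPoch`), a certified Ostrowski-tight family with `t = 2`.
* §4 the checked core of the RANK obstruction F4 (`card_corners_le_rank`, `card_minimal_nonzeros_le_rank`,
  `card_corners_le_of_expSum`, tightness `corners_rank_tight`).
* §5 the checked form of obstruction F8 (`extremePoint_sdiff_zero_of_sum`, `ncard_extremePoints_sdiff_zero_le`,
  `vert_sub_const_le_of_support_eq_sum`: no internal cancellation ⇒ cancelling the constant exposes only first-order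
  points, `≤ Σ_j (|supp f_j| − 1)` new vertices).
* §3 WHY IT RESISTS (paper analysis in the §3 docblock; `FirstOrderCount` records the open strengthening):
  valuative reformulation (vertices = Newton–Puiseux slopes of `W = ∏f − ∏g` over `ℂ((Y))` and `ℂ((1/Y))`);
  between the `≤ 2m(t−1)` critical radii the roots of `W` are the roots of `Λ = Σ log(1+u_j) − Σ log(1+u'_j)`;
  t = 2 ⇒ supports on rays ⇒ `≤ 8m² + O(m)` vertices in ALL regimes (paper theorem, strengthens BinomialPencil);
  common tail support ⇒ RANK obstruction (`≤ 2m` vertices per interval); small-lattice exponents ⇒ lattice-polygon cap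
  `O((m·δ)^{2/3})`; no-internal-cancellation ⇒ only first-order points are exposed.  A counterexample must combine large
  exponents, systematic small-coefficient additive relations and a cancellation identity beating both caps — none of the
  classical identity sources (radix products, cyclic norms, q-products, digit sets, twists, re-pairings, sums of three
  `m`-th powers) does.  Searches (kit/search*.py, exact arithmetic) found no instance beating the first-order baseline.

Prose lives in docstrings; everything not marked `sorry` is kernel-checked.
-/

namespace Summit.ValiantsHypothesis.ValiantsHypothesis.Cruxes.TwoProducts.Disproof

open scoped BigOperators Pointwise
open MvPolynomial Literature.Computability.AlgebraicComplexity

noncomputable section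

/-- The planar point of an exponent vector, exactly as inlined in the crux. [folklore] -/
abbrev ι : (Fin 2 →₀ ℕ) → (Fin 2 → ℝ) := fun e i => ((e i : ℕ) : ℝ)

/-- The vertex count of the crux, as a function of the polynomial (definitionally `newtonVertexCount`). [folklore] -/
abbrev vert (W : MvPolynomial (Fin 2) ℂ) : ℕ :=
  (Set.extremePoints ℝ (convexHull ℝ (ι '' (W.support : Set (Fin 2 →₀ ℕ))))).ncard

/-- Sanity: the crux is literally the `vert`-bound for the difference of the two products. [folklore] -/
theorem twoProducts_iff :
    Theses.NewtonUnitEquations.TwoProducts ↔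
      ∃ a b : ℕ, ∀ (m t : ℕ) (f g : Fin m → MvPolynomial (Fin 2) ℂ), (∀ j, (f j).support.card ≤ t) →
        (∀ j, (g j).support.card ≤ t) → vert (∏ j, f j - ∏ j, g j) ≤ 2 ^ (a * m) * (t + 2) ^ b :=
  Iff.rfl

/-- `vert` is the Literature abbreviation `newtonVertexCount`. [folklore] -/
theorem vert_eq (W : MvPolynomial (Fin 2) ℂ) : vert W = newtonVertexCount W := rfl

/-! ## §1  Load-bearing hypotheses: sparsity of BOTH products, and the `t`-dependence of the bound -/

/-- **The crux with the sparsity hypothesis on the SECOND product DELETED** (a refuted variant, not a fact). -/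
def TwoProductsWithoutSparsityG : Prop :=
  ∃ a b : ℕ, ∀ (m t : ℕ) (f g : Fin m → MvPolynomial (Fin 2) ℂ), (∀ j, (f j).support.card ≤ t) →
    vert (∏ j, f j - ∏ j, g j) ≤ 2 ^ (a * m) * (t + 2) ^ b

/-- **The crux with the sparsity hypothesis on the FIRST product DELETED** (a refuted variant, not a fact). -/
def TwoProductsWithoutSparsityF : Prop :=
  ∃ a b : ℕ, ∀ (m t : ℕ) (f g : Fin m → MvPolynomial (Fin 2) ℂ), (∀ j, (g j).support.card ≤ t) →
    vert (∏ j, f j - ∏ j, g j) ≤ 2 ^ (a * m) * (t + 2) ^ b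

/-- `2^(a+b) < 2^(a+b+1)`, the arithmetic of all the parabola witnesses. [folklore] -/
theorem pow_witness_lt (a b : ℕ) : 2 ^ (a * 1) * (0 + 2) ^ b < 2 ^ (a + b + 1) := by
  rw [mul_one, zero_add, ← pow_add]
  exact Nat.pow_lt_pow_right (by norm_num) (by omega)

/-- **Any proof must use the sparsity of `g`**: with `m = 1`, `t = 0`, `f₀ = 0`, `g₀ = −F_n` (KPTT's parabola
polynomial, `2^n` vertices) the difference is `F_n`. [folklore] -/
theorem twoProducts_false_without_sparsityG : ¬ TwoProductsWithoutSparsityG := by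
  rintro ⟨a, b, h⟩
  have key := h 1 0 (fun _ => 0) (fun _ => -KPTT.kpttPoly (a + b + 1)) (fun _ => by simp)
  simp only [Fin.prod_univ_one, zero_sub, neg_neg] at key
  change newtonVertexCount (KPTT.kpttPoly (a + b + 1)) ≤ _ at key
  rw [KPTT.newtonVertexCount_kpttPoly] at key
  exact absurd (pow_witness_lt a b) (not_lt.2 key)

/-- **Any proof must use the sparsity of `f`** (symmetric witness `f₀ = F_n`, `g₀ = 0`). [folklore] -/
theorem twoProducts_false_without_sparsityF : ¬ TwoProductsWithoutSparsityF := by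
  rintro ⟨a, b, h⟩
  have key := h 1 0 (fun _ => KPTT.kpttPoly (a + b + 1)) (fun _ => 0) (fun _ => by simp)
  simp only [Fin.prod_univ_one, sub_zero] at key
  change newtonVertexCount (KPTT.kpttPoly (a + b + 1)) ≤ _ at key
  rw [KPTT.newtonVertexCount_kpttPoly] at key
  exact absurd (pow_witness_lt a b) (not_lt.2 key)

/-- The support of KPTT's `F_n` has exactly `2^n` monomials. [cite: KoiranPortierTavenasThomasse2015, §3] -/
theorem card_support_kpttPoly (n : ℕ) : (KPTT.kpttPoly n).support.card = 2 ^ n := by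
  rw [KPTT.support_kpttPoly, Finset.card_image_of_injective _ (KPTT.kpttExp_injective n), Finset.card_range]

/-- NATURAL STRENGTHENING REFUTED: the bound cannot be free of `t` (shape `2^(a·m)` alone): one `2^n`-sparse factor
`F_n` against `0` has `2^n > 2^a` vertices. [folklore] -/
theorem not_twoProductsBoundFreeOfT :
    ¬ ∃ a : ℕ, ∀ (m t : ℕ) (f g : Fin m → MvPolynomial (Fin 2) ℂ), (∀ j, (f j).support.card ≤ t) →
      (∀ j, (g j).support.card ≤ t) → vert (∏ j, f j - ∏ j, g j) ≤ 2 ^ (a * m) := by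
  rintro ⟨a, h⟩
  have key := h 1 (2 ^ (a + 1)) (fun _ => KPTT.kpttPoly (a + 1)) (fun _ => 0)
    (fun _ => (card_support_kpttPoly (a + 1)).le) (fun _ => by simp)
  simp only [Fin.prod_univ_one, sub_zero, mul_one] at key
  change newtonVertexCount (KPTT.kpttPoly (a + 1)) ≤ _ at key
  rw [KPTT.newtonVertexCount_kpttPoly] at key
  exact absurd (Nat.pow_lt_pow_right (by norm_num) (Nat.lt_succ_self a)) (not_lt.2 key)

/-! ## §2  The `m`-dependence is load-bearing too: a certified Ostrowski-tight family with `t = 2`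

`Q_n = ∏_{j<n} (1 + X·Y^j)` (a finite `q`-Pochhammer symbol).  Every exponent `(k, s)` in its support has `k ≤ n`
and `s ≥ T k = k(k-1)/2`, and `(k, T k)` occurs with coefficient `1` (`k ≤ n`); the `n+1` parabola points
`(k, T k)` are strictly exposed by `(x,y) ↦ (k - 1/2)x - y`, hence hull vertices.  So `vert Q_n ≥ n + 1` with
2-sparse factors, and no bound of the shape `(t+2)^b` can hold. -/

/-- Triangular numbers `T k = k(k-1)/2`, by recursion (`T (k+1) = T k + k`). [folklore] -/
def T : ℕ → ℕ
  | 0 => 0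
  | k + 1 => T k + k

/-- `T 0 = 0`. [folklore] -/
@[simp] theorem T_zero : T 0 = 0 := rfl

/-- `T (k+1) = T k + k`. [folklore] -/
@[simp] theorem T_succ (k : ℕ) : T (k + 1) = T k + k := rfl

/-- `2·T k = k² - k` over `ℝ`. [folklore] -/
theorem two_mul_T (k : ℕ) : (2 : ℝ) * (T k : ℝ) = (k : ℝ) * k - k := by
  induction k with
  | zero => simp
  | succ k ih => rw [T_succ]; push_cast; nlinarith [ih]

/-- `T` is monotone in the step form we need: `T k + k ≤ T (k + 1)` and hence `T a ≤ T b` for `a ≤ b`. [folklore] -/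
theorem T_mono {a b : ℕ} (h : a ≤ b) : T a ≤ T b := by
  induction h with
  | refl => exact le_rfl
  | step _ ih => exact ih.trans (by rw [T_succ]; omega)

/-- The exponent vector `(k, s)`. [folklore] -/
def ex (k s : ℕ) : Fin 2 →₀ ℕ := Finsupp.single 0 k + Finsupp.single 1 s

/-- First coordinate of `ex k s`. [folklore] -/
@[simp] theorem ex_apply_zero (k s : ℕ) : ex k s 0 = k := by simp [ex]

/-- Second coordinate of `ex k s`. [folklore] -/
@[simp] theorem ex_apply_one (k s : ℕ) : ex k s 1 = s := by simp [ex]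

/-- `ex` is additive. [folklore] -/
theorem ex_add (a b c d : ℕ) : ex a b + ex c d = ex (a + c) (b + d) := by
  ext i; fin_cases i <;> simp

/-- Componentwise order on `ex`. [folklore] -/
theorem ex_le_iff (a b c d : ℕ) : ex a b ≤ ex c d ↔ a ≤ c ∧ b ≤ d := by
  rw [Finsupp.le_def, Fin.forall_fin_two, ex_apply_zero, ex_apply_zero, ex_apply_one, ex_apply_one]

/-- Every exponent vector is an `ex`. [folklore] -/
theorem ex_eq (e : Fin 2 →₀ ℕ) : e = ex (e 0) (e 1) := by
  ext i; fin_cases i <;> simp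

/-- `ex` is injective in both arguments. [folklore] -/
theorem ex_injective2 {a b c d : ℕ} (h : ex a b = ex c d) : a = c ∧ b = d :=
  ⟨by simpa using congrArg (fun e => e 0) h, by simpa using congrArg (fun e => e 1) h⟩

/-- The binomial factor `1 + X·Y^j`. [folklore] -/
def qFactor (j : ℕ) : MvPolynomial (Fin 2) ℂ := 1 + monomial (ex 1 j) 1

/-- `Q_n = ∏_{j<n} (1 + X·Y^j)`. [folklore] -/
def qPoch (n : ℕ) : MvPolynomial (Fin 2) ℂ := ∏ j ∈ Finset.range n, qFactor j

/-- The defining recursion `Q_{n+1} = Q_n + Q_n·X·Y^n`. [folklore] -/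
theorem qPoch_succ (n : ℕ) : qPoch (n + 1) = qPoch n + qPoch n * monomial (ex 1 n) 1 := by
  rw [qPoch, Finset.prod_range_succ, ← qPoch, qFactor, mul_add, mul_one]

/-- Each factor is 2-sparse. [folklore] -/
theorem card_support_qFactor (j : ℕ) : (qFactor j).support.card ≤ 2 := by
  classical
  unfold qFactor
  calc (1 + monomial (ex 1 j) (1 : ℂ)).support.card
      ≤ ((1 : MvPolynomial (Fin 2) ℂ).support ∪ (monomial (ex 1 j) (1 : ℂ)).support).card :=
        Finset.card_le_card support_add
    _ ≤ (1 : MvPolynomial (Fin 2) ℂ).support.card + (monomial (ex 1 j) (1 : ℂ)).support.card :=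
        Finset.card_union_le _ _
    _ ≤ 1 + 1 := Nat.add_le_add (by rw [support_one, Finset.card_singleton])
        ((Finset.card_le_card support_monomial_subset).trans (by rw [Finset.card_singleton]))

/-- SUPPORT SHAPE: every monomial `X^k Y^s` of `Q_n` has `k ≤ n` and `s ≥ T k`. [folklore] -/
theorem support_qPoch (n : ℕ) : ∀ e ∈ (qPoch n).support, e 0 ≤ n ∧ T (e 0) ≤ e 1 := by
  classical
  induction n with
  | zero =>
    intro e he
    rw [qPoch, Finset.range_zero, Finset.prod_empty, support_one, Finset.mem_singleton] at he
    subst he; simp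
  | succ n ih =>
    intro e he
    rw [qPoch_succ] at he
    rcases Finset.mem_union.1 (support_add he) with h | h
    · obtain ⟨h1, h2⟩ := ih e h
      exact ⟨Nat.le_succ_of_le h1, h2⟩
    · obtain ⟨a, ha, b, hb, rfl⟩ := Finset.mem_add.1 (support_mul _ _ h)
      have hb' : b = ex 1 n := Finset.mem_singleton.1 (support_monomial_subset hb)
      subst hb'
      obtain ⟨h1, h2⟩ := ih a ha
      refine ⟨?_, ?_⟩
      · simp only [Finsupp.coe_add, Pi.add_apply, ex_apply_zero]; omega
      · simp only [Finsupp.coe_add, Pi.add_apply, ex_apply_zero, ex_apply_one, T_succ]; omega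

/-- PARABOLA POINTS PRESENT: the coefficient of `X^k Y^{T k}` in `Q_n` is `1` for `k ≤ n`
(the unique way is to pick `X·Y^j` from the factors `j < k`). [folklore] -/
theorem coeff_qPoch_parabola (n : ℕ) : ∀ k ≤ n, coeff (ex k (T k)) (qPoch n) = 1 := by
  classical
  induction n with
  | zero =>
    intro k hk
    obtain rfl : k = 0 := Nat.le_zero.1 hk
    rw [qPoch, Finset.range_zero, Finset.prod_empty]
    simp [ex]
  | succ n ih =>
    intro k hk
    rw [qPoch_succ, coeff_add, coeff_mul_monomial', mul_one]
    rcases Nat.lt_or_ge n k with hlt | hle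
    · -- k = n + 1: the first summand vanishes, the second is the parabola point of level n
      obtain rfl : k = n + 1 := le_antisymm hk hlt
      have h0 : coeff (ex (n + 1) (T (n + 1))) (qPoch n) = 0 := by
        rw [← notMem_support_iff]
        intro hmem
        have := (support_qPoch n _ hmem).1
        simp at this
      have hle' : ex 1 n ≤ ex (n + 1) (T (n + 1)) := by rw [ex_le_iff, T_succ]; omega
      have hsub : ex (n + 1) (T (n + 1)) - ex 1 n = ex n (T n) := by
        apply tsub_eq_of_eq_add; rw [ex_add, T_succ]
      rw [h0, if_pos hle', hsub, ih n le_rfl, zero_add]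
    · -- k ≤ n: the first summand is 1, the second vanishes
      rw [ih k hle]
      split_ifs with hle'
      · rw [ex_le_iff] at hle'
        have hsub : ex k (T k) - ex 1 n = ex (k - 1) (T k - n) := by
          apply tsub_eq_of_eq_add; rw [ex_add]; congr 1 <;> omega
        have h0 : coeff (ex (k - 1) (T k - n)) (qPoch n) = 0 := by
          rw [← notMem_support_iff]
          intro hmem
          have h := (support_qPoch n _ hmem).2
          simp only [ex_apply_zero, ex_apply_one] at h
          -- T (k-1) ≤ T k - n with T k = T (k-1) + (k-1) forces n ≤ k - 1 < k ≤ n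
          obtain ⟨k', rfl⟩ : ∃ k', k = k' + 1 := ⟨k - 1, by omega⟩
          simp only [Nat.add_sub_cancel, T_succ] at h hle' hle
          omega
        rw [hsub, h0, add_zero]
      · rw [add_zero]

/-- The planar parabola point `(k, T k)`. [folklore] -/
def parabPt (k : ℕ) : Fin 2 → ℝ := ι (ex k (T k))

/-- First coordinate of the parabola point. [folklore] -/
@[simp] theorem parabPt_zero (k : ℕ) : parabPt k 0 = k := by simp [parabPt, ι]

/-- Second coordinate of the parabola point. [folklore] -/
@[simp] theorem parabPt_one (k : ℕ) : parabPt k 1 = T k := by simp [parabPt, ι]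

/-- The parabola points are pairwise distinct. [folklore] -/
theorem parabPt_injective : Function.Injective parabPt := fun a b h => by
  have := congrArg (fun q => q 0) h
  simpa using this

/-- The exposing functional at level `k`: `(x, y) ↦ (k - 1/2)·x - y`. [folklore] -/
def expo (k : ℕ) : (Fin 2 → ℝ) →ₗ[ℝ] ℝ :=
  ((k : ℝ) - 1 / 2) • LinearMap.proj 0 - LinearMap.proj 1

/-- The exposing functional, evaluated. [folklore] -/
@[simp] theorem expo_apply (k : ℕ) (q : Fin 2 → ℝ) : expo k q = ((k : ℝ) - 1 / 2) * q 0 - q 1 := by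
  simp [expo]

/-- STRICT EXPOSURE: on the support of `Q_n`, `expo k` is uniquely maximised at `(k, T k)`
(`expo k (k, T k) - expo k (x, y) ≥ (k - x)²/2`, with equality only if `y = T x`). [folklore] -/
theorem expo_lt (n k : ℕ) {e : Fin 2 →₀ ℕ} (he : e ∈ (qPoch n).support) (hne : ι e ≠ parabPt k) :
    expo k (ι e) < expo k (parabPt k) := by
  obtain ⟨-, hT⟩ := support_qPoch n e he
  have hT' : (T (e 0) : ℝ) ≤ (e 1 : ℝ) := by exact_mod_cast hT
  have h2e := two_mul_T (e 0)
  have h2k := two_mul_T k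
  simp only [expo_apply, parabPt_zero, parabPt_one]
  simp only [ι]
  by_cases hx : e 0 = k
  · -- same column: then e 1 > T k (else the points coincide)
    have hy : e 1 ≠ T k := by
      intro hy
      apply hne
      rw [ex_eq e, hx, hy]; rfl
    have hlt : (T k : ℝ) < (e 1 : ℝ) := by
      rw [hx] at hT
      exact_mod_cast lt_of_le_of_ne hT (Ne.symm hy)
    rw [hx] at h2e ⊢
    linarith
  · have hsq : (0 : ℝ) < ((e 0 : ℝ) - k) ^ 2 := by
      have : (e 0 : ℝ) - k ≠ 0 := sub_ne_zero.2 (by exact_mod_cast hx)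
      positivity
    nlinarith

/-- **`Q_n` has at least `n + 1` hull vertices** (the lower parabola; in fact exactly `2n` for `n ≥ 2`). [folklore] -/
theorem le_vert_qPoch (n : ℕ) : n + 1 ≤ vert (qPoch n) := by
  classical
  set S : Set (Fin 2 → ℝ) := ι '' ((qPoch n).support : Set (Fin 2 →₀ ℕ)) with hS
  have hfin : ((convexHull ℝ S).extremePoints ℝ).Finite :=
    (Set.Finite.image ι (Finset.finite_toSet _)).subset extremePoints_convexHull_subset
  have hsub : parabPt '' (Finset.range (n + 1) : Set ℕ) ⊆ (convexHull ℝ S).extremePoints ℝ := by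
    rintro p ⟨k, hk, rfl⟩
    have hk' : k ≤ n := Nat.lt_succ_iff.1 (Finset.mem_range.1 (Finset.mem_coe.1 hk))
    have hp : parabPt k ∈ S := ⟨ex k (T k), by
      rw [Finset.mem_coe, mem_support_iff, coeff_qPoch_parabola n k hk']; exact one_ne_zero, rfl⟩
    refine KPTT.mem_extremePoints_convexHull_of_linear hp (expo k) ?_
    rintro q ⟨e, he, rfl⟩ hne
    exact expo_lt n k (Finset.mem_coe.1 he) hne
  calc n + 1 = (parabPt '' (Finset.range (n + 1) : Set ℕ)).ncard := by
        rw [Set.ncard_image_of_injective _ parabPt_injective, Set.ncard_coe_finset, Finset.card_range]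
    _ ≤ ((convexHull ℝ S).extremePoints ℝ).ncard := Set.ncard_le_ncard hsub hfin

/-- NATURAL STRENGTHENING REFUTED: the bound cannot be free of `m` (shape `(t+2)^b` alone, i.e. "polynomial in
`t` uniformly in the number of factors"): `Q_n` with `n = 4^b` binomial factors against `0` has `> 4^b` vertices.
[folklore] -/
theorem not_twoProductsBoundFreeOfM :
    ¬ ∃ b : ℕ, ∀ (m t : ℕ) (f g : Fin m → MvPolynomial (Fin 2) ℂ), (∀ j, (f j).support.card ≤ t) →
      (∀ j, (g j).support.card ≤ t) → vert (∏ j, f j - ∏ j, g j) ≤ (t + 2) ^ b := by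
  rintro ⟨b, h⟩
  set n : ℕ := 4 ^ b with hn
  have hn1 : 1 ≤ n := Nat.one_le_pow _ _ (by norm_num)
  have key := h n 2 (fun j => qFactor j) (fun _ => 0) (fun j => card_support_qFactor j) (fun _ => by simp)
  have hprod : (∏ j : Fin n, qFactor j) = qPoch n := by
    rw [qPoch, ← Fin.prod_univ_eq_prod_range]
  have hzero : (∏ _j : Fin n, (0 : MvPolynomial (Fin 2) ℂ)) = 0 :=
    Finset.prod_eq_zero (Finset.mem_univ (⟨0, hn1⟩ : Fin n)) rfl
  rw [hprod, hzero, sub_zero] at key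
  have hv := le_vert_qPoch n
  have h4 : (2 + 2) ^ b = n := by rw [hn]
  omega

/-! ## §3  Why it resists — the obstruction ledger (paper analysis; nothing here is asserted in Lean)

Notation: `W = ∏_j f_j − ∏_j g_j`, `K = ℂ((Y))`, `v = ord_Y`.  All of this is written out in the seat's NOTES.md
(§Findings F1–F9) and agrees with the two round-1 ideator cards `corner-log-linearization` / `formal-log-linearisation`
(which found the same log-linearisation lever independently).

* **F1 (valuative reformulation).** `#vert Newt(W) ≤ #edges(lower hull) + #edges(upper hull) + 2`, and the lower-hull
  edges are the distinct slopes of the Newton polygon of `W ∈ K[X]`, i.e. the distinct valuations of its Puiseux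
  roots (upper hull: `ord_{1/Y}`).
* **F2 (localisation).** Critical radii := root valuations of the individual `t`-nomials (`≤ 2m(t−1)`).  On an open
  interval `I` between consecutive ones every factor has one dominant monomial; normalising `f_j = μ_j(1+u_j)`,
  `g_j = μ'_j(1+u'_j)` (`|u|<1` on `I`): if `∏μ_j`, `∏μ'_j` differ in `X`-degree there is `≤ 1` root valuation in
  `I`; if they differ in the constant there is none; otherwise the roots of `W` in the annulus are the roots of the
  analytic function `Λ_I = Σ_j log(1+u_j) − Σ_j log(1+u'_j)` (`exp Λ − 1 = Λ·unit`), counted by the Newton polygon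
  of the Laurent series `Λ_I` restricted to slopes in `I` (=: `V_I` vertices).
* **F3 (t = 2 is a THEOREM, all regimes).** For binomials each `log(1+u_j)` lives on one ray, so `V_I ≤ 2m`:
  `#vert ≤ 2·(2m + (2m+1)·2m) + 2 = 8m² + 8m + 2` for ARBITRARY binomials (no distinct-subset-sum / nonvanishing
  hypotheses) — strictly stronger than route item BinomialPencil (stmt-5908); `t = 2` can never refute anyway
  (`|supp W| ≤ 2^{m+1}`).  Typed by ideator 2 as `TwoProductsBinomial` (Sketch); a prover's target, not landed here.
* **F4 (RANK obstruction).** If on `I` all `2m` normalised factors share the same two tail monomials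
  (`1 + α_j S + β_j T`), the coefficient of `S^pT^q` in `Λ_I` is `c_pq·G(p,q)`, `c_pq ≠ 0`,
  `G(p,q) = Σ_j α_j^pβ_j^q − Σ_j α'_j^pβ'_j^q` — a matrix of rank `≤ 2m`; vertices inside `I` are outer corners of
  the maximal down-set of zeros of `G`, and `V` corners carve a `V×V` triangular minor with nonzero diagonal:
  `V_I ≤ 2m`.  (General lifted form: with one variable `y_i` per distinct tail monomial, the coefficient of `y^μ` in
  `Σ_j ε_j log(1+ℓ_j(y))` is `c_μ·F(μ)`, `F(μ) = Σ_j ε_j a_j^μ` — a signed sum of `2m` monomial characters of `ℕ^s`,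
  i.e. exactly a unit-equation / vanishing-moment object; the planar coefficient is the fibre sum
  `Σ_{π(μ)=x} c_μ F(μ)` over the exponent map `π`.)
* **F5 (generic exponents).** Without low-order additive coincidences among the tail vectors, interior cone points
  have unique representations, never cancel, and block everything above them: `V_I = O(m)`.
* **F6 (lattice cap).** If all tail vectors are combinations with coordinates `≤ δ` of two base vectors, `W` is a
  polynomial of degree `≤ mδ` in `(S,T)` and has `O((mδ)^{2/3})` vertices (Andrews / Acketa–Žunić).
* **F7 (where a counterexample must live, and what is dead).** `t^{cm}/(2mt)` root valuations inside ONE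
  non-critical interval, from tail configurations with large exponents AND systematic small-coefficient relations
  AND a cancellation identity beating both F4 and F6.  Dead by the above: radix/telescoping identities
  `(1−z)∏(1+z^{2^i}) = 1 − z^{2^n}` (rays; F3), cyclic norms `∏_k h(ω^k X, ω^{lk} Y)` and general torus twists
  `∏_j h(α_jX,β_jY) − ∏_j h(α'_jX,β'_jY)` (survivors = `supp(log h) ∖ {Φ = 0}` with `Φ` a planar `2m`-term
  exponential sum: `≤ 2m` staircase corners + atoms of a 2D monoid, poly(m,t)), `q`-products `∏(1+Y^kX)` (the
  parabola IS the zonogon boundary: Ostrowski-tight, §2), digit-product / mixed-radix sets (no internal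
  cancellation ⇒ F8), complex-base (twindragon) digits (binomials ⇒ F3), re-pairings of monomials between factors
  (common factors split off; one-change escape), twists `Q = c·P(λX,μY)` (hyperplane avoidance ⇒ one-change
  escape ⇒ poly), sums of three `m`-th powers `a^m+b^m+c^m = ∏_j(a−ω_jb) − ∏_j(−η_jc)` (same obstructions),
  circulant determinants `det(I + Σ_c φ_c C^c)` = products of `q` twisted `(s+1)`-nomials (lifted support = ALL
  lattice points `{μ : Σ cμ_c ≡ 0 (q)}`, atoms = minimal zero-sum sequences; but the 2D shadow keeps only `≈ q`
  frontier vertices: kit/zerosum.py, `q ≤ 8`: 3,4,6,5,7,8 against baselines `q(q−1)`), and more generally any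
  "clone" structure (identical coefficient columns) is neutralised by the 2D shadow (per direction one clone per
  class matters), which is WHY the weak shape `2^{O(m)}·poly(t)` is natural: the `m`-complexity of the lifted
  zero set may be exponential, the `t`-dependence seen by a planar shadow is polynomial.
* **F8 (lemma, paper).** If `∏f_j` has no internal cancellation (support = Minkowski sum of the supports, all
  `∋ 0`) then every vertex of `Newt(∏f_j + c)` that is not a vertex of `Newt(∏f_j)` is a first-order point
  (an element of some `supp f_j`): a sum of `≥ 2` nonzero support points lies strictly inside every half-plane
  separating `conv(S∖0)` from `0`.  So digit-product sets expose `≤ m(t−1)` vertices.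
* **F9 (reformulation of KPTT §5.2, local form).** `ndiag(∏f_j − 1)` is large iff `∏ f_j ≡ 1` modulo a monomial
  ideal whose co-ideal is a down-set with many strictly convex corners (`|R| ≥ c·V³` forced); radix identities give
  intervals/boxes only.  OPEN NATURAL STRENGTHENING we could not refute ("first-order count", FOC):
  `ndiag(∏_{j<m} f_j − 1) ≤ Σ_j (|supp f_j| − 1)` and, for two products, `V_I ≤ 2m(t−1)`; true for `t = 2` (rays),
  in the common-cone case (rank), for all cyclic/twisted designs (sails have `O(log m)` vertices), and in every
  search run (kit job j009011, kit/search*.py, exact arithmetic / 𝔽_p with roots of unity): no instance found with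
  more Newton-diagram vertices than first-order monomials.  A refutation of FOC would be the first genuinely
  "deep" cascade and is the recommended next experiment for any disprover; KPTT App. example
  (`fg+1 = 2X³Y³ − ¼(X⁴Y⁸+2X⁶Y⁶+X⁸Y⁴)`, hidden order-2 vertex `X³Y³`) shows deep vertices EXIST but do not
  outnumber the first-order budget.

* **F10 (rank-ρ log-coefficient structure; bi-covering knapsack shadows).**  The only regime the rank argument F4 does
  not cap (drefute remark (a): common support with `s = t−1 ≥ 3` tail monomials, box bound `(2n)^s` only) was probed in
  its IDEALISED form: coefficients `a_ji = c_i λ_j^{w_i} κ_j^{w'_i}` make the lifted zero set the preimage under the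
  linear map `ω = (w,w') : ℕ^s → ℕ²` of the zero set of a planar `2n`-term exponential sum (≤ 2n corners by F4), so the
  survivors are unions of `≤ 2n` bi-covering-knapsack sets `{μ : ⟨w,μ⟩ ≥ A, ⟨w',μ⟩ ≥ B}` and the frontier is their planar
  shadow under the (unrelated, generic) exponent map `π`.  Even granting ARBITRARY corners (ignoring that bivariate PTE
  agreement sets are `O(n)` points or lattices), the shadow count is tiny: `kit/knap/biknap.py`, `n ∈ {3,4}`, `s ≤ 9`:
  best `K = 3,4,6,7,8,10,10,11` resp. `3,5,6,8,9,10,11` ≈ `s + 3`, against first-order budgets `2ns = 12…64`.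
  Structured (cyclic) agreement sets give lattice survivors (circulant family, F7) — also `≈ q` vertices.  Dead.

VERDICT for provers: every counterexample mechanism we know collapses to `2^{O(m)}·poly(t)` or less; the crux is
most plausibly TRUE, with the valuative/log-linearised count (F2) + a structure theorem for the lifted zero set
`{μ : Σ_j ε_j a_j^μ = 0}` (Laurent / unit equations, used qualitatively) + planar-shadow counting as the route.
Heuristic behind FOC (F9): each exposed higher-order vertex costs ≥ 1 independent polynomial condition on the
`2n(t−1)` tail coefficients, and planar convexity refunds nothing (killing a midpoint-chain vertex `v_i+v_{i+1}` exposes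
at most ONE of `v_{i−1}+v_{i+1}`, `v_i+v_{i+2}`: their midpoint lies on the new chord) — so generic designs saturate at the
first-order budget, exactly what every search shows.

`-- Targets` (line PICKED 2026-08-16T03:09Z: `corner-log-linearization`, skeleton `Lines/corner-log-linearization.lean`,
7 registered stubs; `stuck_stubs = []` so far).  Read with the drefute seat's `DrefuteNotes-corner-log-linearization-r1.md`
(0 stub-false / 0 misstated / 7 survived; I concur):  `stub_exposure` — TRUE, and its real-functional core is CHECKED
here (§5 `exists_strict_exposing_of_finite`, landing as `Theorems/TwoProducts/Negative/FirstOrderExposure.lean`; only the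
integer rounding on a finite set remains);  `stub_sweep`, `stub_sectorCover`, `stub_coneChart` — true bookkeeping (F2 is
the same localisation);  `stub_powerSumCriterion` — true (exp/log in the `w`-graded completion; both weights positive is
load-bearing, drefute's explicit failure at `w = (1,0)`);  `stub_raySeries` — true (= F3's ray argument);
`stub_logSumNewton` — OPEN and crux-equivalent (¬stub ⇒ ¬TwoProducts through the true stubs 2–4), so it has no kill
short of a counterexample to the crux; everything in F3–F10 applies to it verbatim (it IS the local count `V_I`).
No `<stub>_false` theorem exists or is expected.
`-- NEAR-MISSES`: none.
-/

/-- Anchor for §3: the "first-order count" strengthening (FOC) of KPTT §5.2, recorded as an OPEN `Prop` we could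
neither prove nor refute (module docstring §3/F9).  Global-hull form for one product with constant terms `1`:
the vertices of `Newt(∏ f_j − 1)` are the `≤ m·t` outer vertices of `Newt(∏ f_j)` other than the origin plus the
hidden ones exposed by cancelling the constant, and FOC says the hidden ones never outnumber the first-order
monomials, `≤ Σ_j (|supp f_j| − 1) ≤ m(t−1)`.  True for `t ≤ 2`, in the common-cone case, for cyclic/twisted
designs, and in all searches; a counterexample would be the first deep cascade.  (An OPEN variant, not a fact.) -/
def FirstOrderCount : Prop :=
  ∀ (m t : ℕ) (f : Fin m → MvPolynomial (Fin 2) ℂ), (∀ j, (f j).support.card ≤ t) → (∀ j, coeff 0 (f j) = 1) →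
    vert (∏ j, f j - 1) ≤ m * (t - 1) + m * t

/-! ## §4  The checked core of the RANK obstruction (F4)

Used on every non-critical interval whose `2m` normalised factors share one tail cone (and by the
`formal-log-linearisation` line: "each row is an LRS of order ≤ 2m … hidden vertices lie in a (2m+1)×(2m+1)
grid"): the coefficient pattern `G(p,q) = Σ_{j<r} a_j(p)·b_j(q)` (for two products `r = 2m`,
`a_j(p) = ε_jα_j^p`, `b_j(q) = β_j^q`) has at most `r` minimal nonzeros, hence the Newton polygon of `Λ_I` has
at most `r` vertices inside the interval.  Pure linear algebra: the `V×V` matrix `(G(p_i,q_k))` on the corners is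
lower triangular with nonzero diagonal, so it is invertible, and it factors through `Fin r`. -/

/-- **Rank obstruction (staircase corners of a low-rank zero pattern).**  If `G p q = ∑_{j<r} a_j(p) b_j(q)`
and `(p_i, q_i)_{i<V}` satisfy `G (p_i) (q_i) ≠ 0` but `G (p_i) (q_k) = 0` whenever `i < k` (the pattern of the
outer corners `p_0 < p_1 < ⋯`, `q_0 > q_1 > ⋯` of a down-set of zeros), then `V ≤ r`. [folklore] -/
theorem card_corners_le_rank {K : Type*} [Field K] {r V : ℕ} (a b : Fin r → ℕ → K) (G : ℕ → ℕ → K)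
    (hG : ∀ p q, G p q = ∑ j, a j p * b j q) (p q : Fin V → ℕ)
    (hdiag : ∀ i, G (p i) (q i) ≠ 0) (hupper : ∀ i k, i < k → G (p i) (q k) = 0) : V ≤ r := by
  classical
  let M : Matrix (Fin V) (Fin V) K := fun i k => G (p i) (q k)
  let A : Matrix (Fin V) (Fin r) K := fun i j => a j (p i)
  let B : Matrix (Fin r) (Fin V) K := fun j k => b j (q k)
  have hM : M = A * B := by
    ext i k
    simp only [M, A, B, Matrix.mul_apply, hG]
  have htri : M.BlockTriangular OrderDual.toDual := fun i k hik => hupper i k (by simpa using hik)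
  have hdet : M.det ≠ 0 := by
    rw [Matrix.det_of_lowerTriangular M htri]
    exact Finset.prod_ne_zero_iff.2 (fun i _ => hdiag i)
  have hunit : IsUnit M := (Matrix.isUnit_iff_isUnit_det M).2 (isUnit_iff_ne_zero.2 hdet)
  have h1 : M.rank = V := by rw [Matrix.rank_of_isUnit M hunit, Fintype.card_fin]
  have h2 : M.rank ≤ r := by
    rw [hM]
    exact (Matrix.rank_mul_le_left A B).trans (by simpa using Matrix.rank_le_card_width A)
  omega

/-- Geometric form: minimal nonzeros of a rank-`≤ r` pattern (points `x_i = (p_i,q_i)`, `p` strictly increasing,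
`G ≠ 0` at `x_i`, `G = 0` at every lattice point weakly below `x_i` other than `x_i`) number at most `r`.
(For two products `G 0 0 = Σ_j ε_j = 0`, so the outer corners of the maximal down-set of zeros qualify.) [folklore] -/
theorem card_minimal_nonzeros_le_rank {K : Type*} [Field K] {r V : ℕ} (a b : Fin r → ℕ → K) (G : ℕ → ℕ → K)
    (hG : ∀ p q, G p q = ∑ j, a j p * b j q) (p q : Fin V → ℕ) (hp : StrictMono p)
    (hne : ∀ i, G (p i) (q i) ≠ 0)
    (hbelow : ∀ i p' q', p' ≤ p i → q' ≤ q i → (p', q') ≠ (p i, q i) → G p' q' = 0) : V ≤ r :=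
  card_corners_le_rank a b G hG p q hne fun i k hik =>
    hbelow k (p i) (q k) (hp hik).le le_rfl fun h => by
      have h1 := (Prod.mk.inj h).1
      have h2 := hp hik
      omega

/-- The exponential-sum instance (two products on a common tail cone, `r = 2m`): a signed sum of `r` planar
monomial characters `G p q = ∑_j ε_j α_j^p β_j^q` has at most `r` staircase corners in its zero pattern. [folklore] -/
theorem card_corners_le_of_expSum {K : Type*} [Field K] {r V : ℕ} (ε α β : Fin r → K) (G : ℕ → ℕ → K)
    (hG : ∀ p q, G p q = ∑ j, ε j * α j ^ p * β j ^ q) (p q : Fin V → ℕ)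
    (hdiag : ∀ i, G (p i) (q i) ≠ 0) (hupper : ∀ i k, i < k → G (p i) (q k) = 0) : V ≤ r :=
  card_corners_le_rank (fun j p => ε j * α j ^ p) (fun j q => β j ^ q) G hG p q hdiag hupper

/-- TIGHTNESS of the rank obstruction: `r` corners do occur for rank `r` — the anti-diagonal pattern
`G p q = Σ_{j<r} [p = j]·[q = r-1-j]` has the `r` corners `(i, r-1-i)` (nonzero there, zero at `(i, r-1-k)` for
`i < k`).  So "≤ 2m vertices per interval" cannot be improved inside the rank argument alone. [folklore] -/
theorem corners_rank_tight (r : ℕ) :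
    ∃ (a b : Fin r → ℕ → ℚ) (p q : Fin r → ℕ), StrictMono p ∧
      (∀ i, (∑ j, a j (p i) * b j (q i)) ≠ 0) ∧ (∀ i k, i < k → (∑ j, a j (p i) * b j (q k)) = 0) := by
  classical
  refine ⟨fun j p => if p = j then 1 else 0, fun j q => if q = r - 1 - j then 1 else 0,
    fun i => i, fun i => r - 1 - i, fun i k h => h, fun i => ?_, fun i k hik => ?_⟩
  · rw [Finset.sum_eq_single i]
    · simp
    · intro j _ hji
      have : (i : ℕ) ≠ j := fun h => hji (Fin.ext h).symm
      simp [this]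
    · simp
  · refine Finset.sum_eq_zero fun j _ => ?_
    by_cases h1 : (i : ℕ) = j
    · have hk : (r - 1 - (k : ℕ)) ≠ r - 1 - (j : ℕ) := by
        have := k.isLt; have := j.isLt; have : (i : ℕ) < k := hik; omega
      simp [h1, hk]
    · simp [h1]

/-! ## §5  The checked form of obstruction F8: without internal cancellation only first-order points are exposed

Convex geometry in any locally convex Hausdorff real vector space (strict exposure of the vertices of a finite
configuration via geometric Hahn–Banach), then the crux's own objects: if `supp ∏ f_j = Σ_j supp f_j` then
`vert(∏ f_j − const) ≤ vert(∏ f_j) + Σ_j (|supp f_j| − 1)`.  So every construction of the F7 list that has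
unique representations (digit products, mixed radix without carries, Sierpinski frames) is harmless at `g ≡ 1`. -/

section FirstOrder

variable {E : Type*} [AddCommGroup E] [Module ℝ E]

/-- An extreme point of the convex hull of `T` is not in the convex hull of the other points. [folklore] -/
theorem not_mem_convexHull_diff_of_mem_extremePoints {T : Set E} {p : E}
    (hp : p ∈ (convexHull ℝ T).extremePoints ℝ) : p ∉ convexHull ℝ (T \ {p}) := by
  have hconv := ((convex_convexHull ℝ T).mem_extremePoints_iff_convex_sdiff.1 hp).2
  have hsub : convexHull ℝ (T \ {p}) ⊆ convexHull ℝ T \ {p} :=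
    convexHull_min (fun x hx => ⟨subset_convexHull ℝ T hx.1, hx.2⟩) hconv
  exact fun h => (hsub h).2 rfl

variable [TopologicalSpace E] [IsTopologicalAddGroup E] [ContinuousSMul ℝ E] [LocallyConvexSpace ℝ E]
  [T2Space E]

/-- In a locally convex Hausdorff space, an extreme point of the convex hull of a FINITE set is strictly
exposed against the other points of the set by a continuous linear functional. [folklore] -/
theorem exists_strict_exposing_of_finite {T : Set E} (hT : T.Finite) {p : E}
    (hp : p ∈ (convexHull ℝ T).extremePoints ℝ) :
    ∃ l : E →ₗ[ℝ] ℝ, ∀ x ∈ T, x ≠ p → l x < l p := by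
  have hnot : p ∉ convexHull ℝ (T \ {p}) := not_mem_convexHull_diff_of_mem_extremePoints hp
  obtain ⟨f, u, hfu, hgt⟩ := geometric_hahn_banach_point_closed (convex_convexHull ℝ (T \ {p}))
    ((hT.subset Set.sdiff_subset).isClosed_convexHull ℝ) hnot
  refine ⟨-(f : E →ₗ[ℝ] ℝ), fun x hx hxp => ?_⟩
  have hx' : u < f x := hgt x (subset_convexHull ℝ _ ⟨hx, hxp⟩)
  simp only [LinearMap.neg_apply, ContinuousLinearMap.coe_coe, neg_lt_neg_iff]
  exact hfu.trans hx'

omit [Module ℝ E] [TopologicalSpace E] [IsTopologicalAddGroup E] [ContinuousSMul ℝ E] [LocallyConvexSpace ℝ E]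
  [T2Space E] in
/-- A Minkowski sum of finitely many finite sets is finite. [folklore] -/
theorem finite_fintype_sum {m : ℕ} (A : Fin m → Finset E) : (∑ j, (A j : Set E)).Finite := by
  classical
  refine (Set.finite_range (fun g : (∀ j, A j) => ∑ j, ((g j : A j) : E))).subset ?_
  intro x hx
  obtain ⟨g, hg, rfl⟩ := (Set.mem_fintype_sum _ _).1 hx
  exact ⟨fun j => ⟨g j, hg j⟩, rfl⟩

/-- **No internal cancellation ⇒ exposed vertices are first order (obstruction F8).**  Let
`S = A_0 + ⋯ + A_{m-1}` be a Minkowski sum of finite sets each containing `0`.  Every extreme point of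
`conv(S ∖ {0})` is either an extreme point of `conv S` or an element of some `A_j` ("first order").
Hence deleting the origin from a cancellation-free product support exposes at most `Σ_j (#A_j - 1)` new
vertices.  (Proof: `p = Σ a_j`; if two summands are nonzero then `p = a + b` with `a, b ∈ S ∖ 0`; a strict
exposing functional `l` of `p` in `conv(S ∖ 0)` has `l a, l b ≤ l p = l a + l b`, forcing `l p > 0 = l 0`, so `l`
exposes `p` in `conv S` too.) [folklore] -/
theorem extremePoint_sdiff_zero_of_sum {m : ℕ} (A : Fin m → Finset E) (h0 : ∀ j, (0 : E) ∈ A j) {p : E}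
    (hp : p ∈ (convexHull ℝ ((∑ j, (A j : Set E)) \ {0})).extremePoints ℝ) :
    p ∈ (convexHull ℝ (∑ j, (A j : Set E))).extremePoints ℝ ∨ ∃ j, p ∈ A j := by
  classical
  set S : Set E := ∑ j, (A j : Set E) with hS
  have hSfin : S.Finite := finite_fintype_sum A
  have hpS : p ∈ S \ {0} := extremePoints_convexHull_subset hp
  obtain ⟨g, hg, hgsum⟩ := (Set.mem_fintype_sum _ _).1 hpS.1
  -- membership of modified sums
  have mem_S : ∀ g' : Fin m → E, (∀ j, g' j ∈ (A j : Set E)) → ∑ j, g' j ∈ S := fun g' hg' =>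
    (Set.mem_fintype_sum _ _).2 ⟨g', hg', rfl⟩
  by_cases hone : ∃ j₁ j₂, j₁ ≠ j₂ ∧ g j₁ ≠ 0 ∧ g j₂ ≠ 0
  · obtain ⟨j₁, j₂, hne, h1, h2⟩ := hone
    set a : E := g j₁ with ha
    set b : E := ∑ j, Function.update g j₁ 0 j with hb
    have hab : p = a + b := by
      rw [← hgsum, hb, ha]
      rw [← Finset.add_sum_erase Finset.univ g (Finset.mem_univ j₁),
        ← Finset.add_sum_erase Finset.univ (Function.update g j₁ 0) (Finset.mem_univ j₁),
        Function.update_self, zero_add]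
      congr 1
      exact Finset.sum_congr rfl fun j hj => by rw [Function.update_of_ne (Finset.ne_of_mem_erase hj)]
    by_cases hb0 : b = 0
    · right
      refine ⟨j₁, ?_⟩
      have : p = a := by rw [hab, hb0, add_zero]
      rw [this, ha]
      exact hg j₁
    · left
      have haS : a ∈ S := by
        have := mem_S (Function.update (fun _ => (0 : E)) j₁ (g j₁)) (fun j => by
          by_cases hj : j = j₁
          · subst hj; rw [Function.update_self]; exact hg j
          · rw [Function.update_of_ne hj]; exact h0 j)
        rwa [Finset.sum_update_of_mem (Finset.mem_univ j₁), Finset.sum_const_zero, add_zero] at this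
      have hbS : b ∈ S := mem_S _ (fun j => by
        by_cases hj : j = j₁
        · subst hj; rw [Function.update_self]; exact h0 j
        · rw [Function.update_of_ne hj]; exact hg j)
      -- strict exposure of p in conv (S \ {0})
      obtain ⟨l, hl⟩ := exists_strict_exposing_of_finite (hSfin.subset Set.sdiff_subset) hp
      have hK := KPTT.convexHull_subset_insert_halfSpace (S := S \ {0}) (p := p) l hl
      have haK : a = p ∨ l a < l p := hK (subset_convexHull ℝ _ ⟨haS, h1⟩)
      have hbK : b = p ∨ l b < l p := hK (subset_convexHull ℝ _ ⟨hbS, hb0⟩)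
      have hlp : l p = l a + l b := by rw [hab, map_add]
      have hp0 : p ≠ 0 := hpS.2
      have hpos : 0 < l p := by
        rcases haK with hap | hap <;> rcases hbK with hbp | hbp
        · exfalso; apply hp0
          have h2 : p = p + p := by rw [hap, hbp] at hab; exact hab
          have h3 : p + p = p + 0 := by rw [add_zero]; exact h2.symm
          exact add_left_cancel h3
        · rw [hap] at hlp; linarith
        · rw [hbp] at hlp; linarith
        · linarith
      refine KPTT.mem_extremePoints_convexHull_of_linear hpS.1 l fun x hx hxp => ?_
      by_cases hx0 : x = 0
      · rw [hx0, map_zero]; exact hpos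
      · exact hl x ⟨hx, hx0⟩ hxp
  · -- at most one nonzero summand: p is that summand
    right
    push Not at hone
    by_cases hall : ∀ j, g j = 0
    · exfalso
      apply hpS.2
      rw [← hgsum]
      exact Finset.sum_eq_zero fun j _ => hall j
    · push Not at hall
      obtain ⟨j₁, hj₁⟩ := hall
      refine ⟨j₁, ?_⟩
      have : p = g j₁ := by
        rw [← hgsum, Finset.sum_eq_single j₁ (fun j _ hj => hone j₁ j (Ne.symm hj) hj₁)
          (fun h => absurd (Finset.mem_univ j₁) h)]
      rw [this]; exact hg j₁

/-- Counting form of F8: deleting the origin from a cancellation-free `m`-fold product support creates at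
most `Σ_j (#A_j − 1)` vertices beyond those of the full support. [folklore] -/
theorem ncard_extremePoints_sdiff_zero_le {m : ℕ} (A : Fin m → Finset E) (h0 : ∀ j, (0 : E) ∈ A j) :
    ((convexHull ℝ ((∑ j, (A j : Set E)) \ {0})).extremePoints ℝ).ncard ≤
      ((convexHull ℝ (∑ j, (A j : Set E))).extremePoints ℝ).ncard + ∑ j, ((A j).card - 1) := by
  classical
  set S : Set E := ∑ j, (A j : Set E) with hS
  set F : Finset E := Finset.univ.biUnion fun j => (A j).erase 0 with hF
  have hSfin : S.Finite := finite_fintype_sum A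
  have hVfin : ((convexHull ℝ S).extremePoints ℝ).Finite := hSfin.subset extremePoints_convexHull_subset
  have hsub : (convexHull ℝ (S \ {0})).extremePoints ℝ ⊆ (convexHull ℝ S).extremePoints ℝ ∪ (F : Set E) := by
    intro p hp
    rcases extremePoint_sdiff_zero_of_sum A h0 hp with h | ⟨j, hj⟩
    · exact Or.inl h
    · refine Or.inr ?_
      have hp0 : p ≠ 0 := (extremePoints_convexHull_subset hp).2
      simp only [hF, Finset.coe_biUnion, Finset.coe_univ, Set.mem_univ, Set.iUnion_true, Set.mem_iUnion,
        Finset.coe_erase, Set.mem_sdiff, Finset.mem_coe, Set.mem_singleton_iff]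
      exact ⟨j, hj, hp0⟩
  have hFcard : F.card ≤ ∑ j, ((A j).card - 1) := by
    refine Finset.card_biUnion_le.trans (Finset.sum_le_sum fun j _ => ?_)
    rw [Finset.card_erase_of_mem (h0 j)]
  calc ((convexHull ℝ (S \ {0})).extremePoints ℝ).ncard
      ≤ ((convexHull ℝ S).extremePoints ℝ ∪ (F : Set E)).ncard :=
        Set.ncard_le_ncard hsub (hVfin.union F.finite_toSet)
    _ ≤ ((convexHull ℝ S).extremePoints ℝ).ncard + (F : Set E).ncard := Set.ncard_union_le _ _
    _ ≤ ((convexHull ℝ S).extremePoints ℝ).ncard + ∑ j, ((A j).card - 1) := by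
        rw [Set.ncard_coe_finset]; exact Nat.add_le_add_left hFcard _

/-! ### Polynomial form (the crux's own objects) -/

section Poly

open MvPolynomial

/-- The crux's embedding of exponent vectors into the plane, as an additive monoid hom (a helper `def`, not a fact). -/
noncomputable def ιHom : (Fin 2 →₀ ℕ) →+ (Fin 2 → ℝ) where
  toFun e i := ((e i : ℕ) : ℝ)
  map_zero' := by ext i; simp
  map_add' e e' := by ext i; simp

/-- `ιHom` evaluated. [folklore] -/
@[simp] theorem ιHom_apply (e : Fin 2 →₀ ℕ) (i : Fin 2) : ιHom e i = ((e i : ℕ) : ℝ) := rfl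

/-- `ιHom` is injective. [folklore] -/
theorem ιHom_injective : Function.Injective ιHom := fun e e' h => by
  ext i; have := congrArg (fun q => q i) h; simpa using this

/-- Support of `P` minus its constant term: the support with the origin erased. [folklore] -/
theorem support_sub_C_coeff_zero (P : MvPolynomial (Fin 2) ℂ) :
    (P - C (coeff 0 P)).support = P.support.erase 0 := by
  classical
  ext e
  rw [mem_support_iff, Finset.mem_erase, mem_support_iff, coeff_sub, coeff_C]
  by_cases he : e = 0
  · subst he; simp
  · rw [if_neg (Ne.symm he), sub_zero]
    exact ⟨fun h => ⟨he, h⟩, fun h => h.2⟩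

/-- **F8 for polynomials.**  If the product `∏ f_j` has NO internal cancellation — its support is the full
Minkowski sum of the supports — and every factor has a constant term, then cancelling the constant term of the
product (the `m`-factor instance `∏ f_j − c` of the crux with `g ≡` const) creates at most `Σ_j (|supp f_j| − 1)`
vertices beyond the `≤ Σ_j |vert f_j|` of `Newt(∏ f_j)` itself.  All the difficulty of KPTT §5.2 / of the crux at
`g ≡ 1` is therefore INTERNAL cancellation. [folklore] -/
theorem vert_sub_const_le_of_support_eq_sum {m : ℕ} (f : Fin m → MvPolynomial (Fin 2) ℂ)
    (hsupp : (∏ j, f j).support = ∑ j, (f j).support) (h0 : ∀ j, coeff 0 (f j) ≠ 0) :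
    vert (∏ j, f j - C (coeff 0 (∏ j, f j))) ≤ vert (∏ j, f j) + ∑ j, ((f j).support.card - 1) := by
  classical
  set P := ∏ j, f j with hP
  let A : Fin m → Finset (Fin 2 → ℝ) := fun j => (f j).support.image ιHom
  have hι : (ι : (Fin 2 →₀ ℕ) → (Fin 2 → ℝ)) = ⇑ιHom := rfl
  have hA0 : ∀ j, (0 : Fin 2 → ℝ) ∈ A j := fun j =>
    Finset.mem_image.2 ⟨0, mem_support_iff.2 (h0 j), map_zero ιHom⟩
  have hAcard : ∀ j, (A j).card = (f j).support.card := fun j =>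
    Finset.card_image_of_injective _ ιHom_injective
  -- the two supports, pushed into the plane
  have hS : (⇑ιHom '' (P.support : Set (Fin 2 →₀ ℕ))) = ∑ j, (A j : Set (Fin 2 → ℝ)) := by
    rw [hsupp, Finset.coe_sum, Set.image_finsetSum]
    simp [A, Finset.coe_image]
  have hS0 : (⇑ιHom '' ((P - C (coeff 0 P)).support : Set (Fin 2 →₀ ℕ))) =
      (∑ j, (A j : Set (Fin 2 → ℝ))) \ {0} := by
    rw [support_sub_C_coeff_zero, Finset.coe_erase, Set.image_sdiff ιHom_injective, Set.image_singleton,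
      map_zero, hS]
  unfold vert
  rw [hι, hS0, hS]
  calc ((convexHull ℝ ((∑ j, (A j : Set (Fin 2 → ℝ))) \ {0})).extremePoints ℝ).ncard
      ≤ ((convexHull ℝ (∑ j, (A j : Set (Fin 2 → ℝ)))).extremePoints ℝ).ncard + ∑ j, ((A j).card - 1) :=
        ncard_extremePoints_sdiff_zero_le A hA0
    _ = _ := by simp only [hAcard]

end Poly

end FirstOrder

end

end Summit.ValiantsHypothesis.ValiantsHypothesis.Cruxes.TwoProducts.Disproof
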